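import Summits.HodgeConjecture.CorCM.Census.QuaternionColumnFamily
import Summits.HodgeConjecture.CorCM.Census.FibreIndependenceCriteria

/-!
# The quaternion column, VIII-c: the two stabiliser characters and their values on the biarc parity cycles

COR-CM (cell `pub-hodgecm2`), count-neutral kernel combinatorics by the binder seat b09 (gen 39; lane QUATERNION COLUMN), part VIII-c, on parts
I–V (`Census/QuaternionColumn{Biarc,…,Family}.lean`) and the character functionals of `Census/HalfParityCharacters.lean` (`theta`,
`theta_mapDomain_rt`, `rad2_le_ker_theta`) used BY NAME.  Two bookkeeping definitions with bodies (`chiA`, `chiB`: the two index-two characters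
of `Q_{4n}` killing `c`) + theorems; no `decide` beyond closed identities in `𝔽₂`, no certificate, no named fact, no `sorry`.
HONEST FRAMING: `HC_CM` is NOT proved, here or anywhere in the tree; nothing here is a period or a headline.

WHY.  The explicit family `qfam` (part V) has parity rank `2n − 3` on its closing part: the `n` biarc faces `fplus k 0` meet the biarc blocks
`BA_k, BA_{k+2}` with odd parity, so they form TWO parity cycles (even `k`, odd `k`).  The cycle sums are parity-free Hodge vectors, detected
by the stabiliser characters: with `χ_a = [xa-coset]`, `χ_b = parity of the rotation index` (both additive, killing `c` and every type
stabiliser), **`(θ_{χ_a}, θ_{χ_b})(y_even) = (1, 1)` and `(y_odd) = (1, 0)`** (`theta_cycle`) — an invertible matrix.  Mechanism: the two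
middle corners `barc (k+1) 0`, `barc k (−1) = barc (k+1) 0·(a 1)⁻¹` of `fplus k 0` cancel, so `θ(fplus k 0) = θ[barc k 0] + θ[barc (k+2) 0]`,
the cycle telescopes to `θ[barc r 0] + θ[barc (r+n) 0] = χ(xa (r−1))` (`barc (r+n) 0 = barc r 0·(xa (r−1))⁻¹`).

## References
* [Pohlmann1968] H. Pohlmann, Algebraic cycles on abelian varieties of complex multiplication type, Ann. of Math. 88 (1968), Thm 1.
-/

namespace Summit.HodgeConjecture.CorCM.Census.QuaternionColumn

open Finset QuaternionGroup
open Summit.HodgeConjecture.CorCM.Prior.AllgGroup.RfwfAllgGroup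
open Summit.HodgeConjecture.CorCM.Census.BlockParity
open Summit.HodgeConjecture.CorCM.Census.Coinvariant
open Summit.HodgeConjecture.CorCM.Census.HalfParity
open Summit.HodgeConjecture.CorCM.Census.BaseBlock
open Summit.HodgeConjecture.CorCM.Census.TwistGeneration

noncomputable section

variable {n : ℕ} [NeZero n]

/-! ## §1 The two characters -/

/-- **`χ_a`**: the indicator of the reflection coset (`a i ↦ 0`, `xa j ↦ 1`). [folklore] -/
def chiA : QuaternionGroup n → ZMod 2
  | a _ => 0
  | xa _ => 1

/-- **`χ_b`**: the parity of the rotation index (`a i ↦ i mod 2`, `xa j ↦ j mod 2`). [folklore] -/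
def chiB : QuaternionGroup n → ZMod 2
  | a i => ZMod.castHom (dvd_mul_right 2 n) (ZMod 2) i
  | xa j => ZMod.castHom (dvd_mul_right 2 n) (ZMod 2) j

omit [NeZero n] in
/-- `χ_a` is additive. [folklore] -/
theorem chiA_mul (g h : QuaternionGroup n) : chiA (g * h) = chiA g + chiA h := by
  cases g <;> cases h <;> simp [chiA]
  decide

omit [NeZero n] in
/-- In `𝔽₂`, subtraction is addition. [folklore] -/
theorem zmod2_sub (x y : ZMod 2) : x - y = x + y := by
  have h : ∀ y : ZMod 2, -y = y := by decide
  rw [sub_eq_add_neg, h]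

omit [NeZero n] in
/-- `χ_b` is additive (`n` even). [folklore] -/
theorem chiB_mul (heven : Even n) (g h : QuaternionGroup n) : chiB (g * h) = chiB g + chiB h := by
  have hn : ZMod.castHom (dvd_mul_right 2 n) (ZMod 2) ((n : ZMod (2 * n))) = 0 := by
    rw [map_natCast]; exact ZMod.natCast_eq_zero_iff_even.mpr heven
  cases g with
  | a i => cases h with
    | a j => simp [chiB]
    | xa j => simp only [chiB, a_mul_xa, map_sub, zmod2_sub]; ring
  | xa i => cases h with
    | a j => simp [chiB]
    | xa j => simp only [chiB, xa_mul_xa, map_sub, map_add, hn, zmod2_sub]; ring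

omit [NeZero n] in
/-- `χ_a(c) = 0`. [folklore] -/
theorem chiA_c : chiA (c n) = 0 := rfl

omit [NeZero n] in
/-- `χ_b(c) = 0` (`n` even). [folklore] -/
theorem chiB_c (heven : Even n) : chiB (c n) = 0 := by
  show ZMod.castHom (dvd_mul_right 2 n) (ZMod 2) ((n : ZMod (2 * n))) = 0
  rw [map_natCast]; exact ZMod.natCast_eq_zero_iff_even.mpr heven

/-- **No type is fixed by `c`** (`Ψ·c = Ψ̄ ≠ Ψ`). [folklore] -/
theorem rt_c_ne (Ψ : CMF (QuaternionGroup n) (c n)) : rt (c n) (c n) Ψ ≠ Ψ := by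
  intro h
  have hv := congrArg Subtype.val h
  rw [rt_self_val (c n) c_comm] at hv
  have h1 : (1 : QuaternionGroup n) ∈ univ \ Ψ.1 ↔ (1 : QuaternionGroup n) ∈ Ψ.1 := by rw [hv]
  rw [mem_sdiff] at h1
  simp only [mem_univ, true_and] at h1
  exact iff_not_self h1.symm

/-- Iterating a fixing base change. [folklore] -/
theorem rt_pow_eq_self {Q : QuaternionGroup n} {Ψ : CMF (QuaternionGroup n) (c n)} (h : rt (c n) Q Ψ = Ψ) (t : ℕ) : rt (c n) (Q ^ t) Ψ = Ψ := by
  induction t with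
  | zero => rw [pow_zero, rt_one]
  | succ t ih => rw [pow_succ', rt_mul, ih, h]

/-- **Reflections fix no type** (`(xa k)² = c`). [folklore] -/
theorem rt_xa_ne (k : ZMod (2 * n)) (Ψ : CMF (QuaternionGroup n) (c n)) : rt (c n) (xa k) Ψ ≠ Ψ := by
  intro h
  have h2 := rt_pow_eq_self h 2
  rw [sq, xa_mul_xa_self] at h2
  exact rt_c_ne Ψ h2

omit [NeZero n] in
/-- Powers of a rotation: `(a i)^t = a (t·i)`. [folklore] -/
theorem a_pow (i : ZMod (2 * n)) (t : ℕ) : (a i : QuaternionGroup n) ^ t = a ((t : ZMod (2 * n)) * i) := by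
  induction t with
  | zero => rw [pow_zero, Nat.cast_zero, zero_mul, one_def]
  | succ t ih => rw [pow_succ, ih, a_mul_a, Nat.cast_succ]; ring_nf

/-- **An odd rotation fixes no type** when `n = 2^m`: some power of `a i` is `c`. [folklore] -/
theorem rt_a_odd_ne (m : ℕ) (hn : n = 2 ^ m) (i : ZMod (2 * n)) (hi : Odd i.val) (Ψ : CMF (QuaternionGroup n) (c n)) :
    rt (c n) (a i) Ψ ≠ Ψ := by
  intro h
  have hd : 2 * n ∣ 2 ^ (m + 1) := ⟨1, by rw [hn, pow_succ']; ring⟩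
  have hcop : Nat.Coprime i.val (2 * n) :=
    Nat.Coprime.coprime_dvd_right hd ((Nat.coprime_pow_right_iff (by omega) _ _).mpr (Nat.coprime_two_right.mpr hi))
  have hunit : IsUnit (i : ZMod (2 * n)) := by
    have hu := (ZMod.unitOfCoprime i.val hcop).isUnit
    rwa [ZMod.coe_unitOfCoprime, ZMod.natCast_zmod_val] at hu
  -- `t = val (n · i⁻¹)`: `(a i)^t = a (n · i⁻¹ · i) = a n = c`
  have hpow : (a i : QuaternionGroup n) ^ (((n : ZMod (2 * n)) * i⁻¹).val) = c n := by
    rw [a_pow, ZMod.natCast_zmod_val, mul_assoc, ZMod.inv_mul_of_unit i hunit, mul_one]; rfl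
  have h2 := rt_pow_eq_self h (((n : ZMod (2 * n)) * i⁻¹).val)
  rw [hpow] at h2
  exact rt_c_ne Ψ h2

omit [NeZero n] in
/-- The cast `ℤ/2n → 𝔽₂` reads the parity of `val`. [folklore] -/
theorem castHom_eq_one_iff (i : ZMod (2 * n)) [NeZero n] : ZMod.castHom (dvd_mul_right 2 n) (ZMod 2) i = 1 ↔ Odd i.val := by
  rw [ZMod.castHom_apply, ZMod.cast_eq_val, ZMod.natCast_eq_one_iff_odd]

/-- **`χ_a` kills every type stabiliser.** [folklore] -/
theorem chiA_stab (Ψ : CMF (QuaternionGroup n) (c n)) (Q : QuaternionGroup n) (h : rt (c n) Q Ψ = Ψ) : chiA Q = 0 := by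
  cases Q with
  | a i => rfl
  | xa k => exact absurd h (rt_xa_ne k Ψ)

/-- **`χ_b` kills every type stabiliser** (`n = 2^m`). [folklore] -/
theorem chiB_stab (m : ℕ) (hn : n = 2 ^ m) (Ψ : CMF (QuaternionGroup n) (c n)) (Q : QuaternionGroup n) (h : rt (c n) Q Ψ = Ψ) : chiB Q = 0 := by
  cases Q with
  | a i =>
    by_contra hne
    have h1 : chiB (a i : QuaternionGroup n) = 1 := by
      have key : ∀ x : ZMod 2, x ≠ 0 → x = 1 := by decide
      exact key _ hne
    exact rt_a_odd_ne m hn i ((castHom_eq_one_iff i).mp h1) Ψ h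
  | xa k => exact absurd h (rt_xa_ne k Ψ)

/-! ## §2 Block parity and characters of a biarc face; the cycle sums -/

/-- The two middle corners of `fplus k 0` are base changes of each other along `a 1`, and the far corner is `barc (k+2) 0 · (a 1)⁻¹`. [folklore] -/
theorem fplus_corners_rt (k : ZMod (2 * n)) :
    barc k ((0 : ZMod (2 * n)) - 1) = rt (c n) (a 1) (barc (k + 1) 0) ∧ barc (k + 1) ((0 : ZMod (2 * n)) - 1) = rt (c n) (a 1) (barc (k + 2) 0) := by
  constructor
  · rw [rt_a_barc]; congr 1; ring
  · rw [rt_a_barc]; congr 1; ring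

/-- **The block parity of a biarc face**: `par (fplus k 0) = e_{blk (barc k 0)} + e_{blk (barc (k+2) 0)}`. [folklore] -/
theorem par_fplus (k : ZMod (2 * n)) :
    par (c n) (fplus k 0) = Pi.single (blk (c n) (barc k 0)) 1 + Pi.single (blk (c n) (barc (k + 2) 0)) 1 := by
  rw [fplus_eq, map_sub, map_sub, map_add, par_single, par_single, par_single, par_single, (fplus_corners_rt k).1, (fplus_corners_rt k).2,
    blk_rt, blk_rt]
  simp only [one_smul]
  have h2 : ∀ u v w : Block (c n) → ZMod 2, u + v - w - w = u + v := by
    intro u v w; funext b; simp only [Pi.add_apply, Pi.sub_apply]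
    generalize u b = x; generalize v b = y; generalize w b = z; revert x y z; decide
  exact h2 _ _ _

section Theta

variable {χ : QuaternionGroup n → ZMod 2} (hadd : ∀ g h : QuaternionGroup n, χ (g * h) = χ g + χ h)
  (hst : ∀ (Ψ : CMF (QuaternionGroup n) (c n)) (Q : QuaternionGroup n), rt (c n) Q Ψ = Ψ → χ Q = 0)
include hadd hst

/-- `θ_χ` of a base-changed type: `θ_χ[Ψ·Q⁻¹] = θ_χ[Ψ] + χ(Q)`. [folklore] -/
theorem theta_single_rt (Q : QuaternionGroup n) (Ψ : CMF (QuaternionGroup n) (c n)) :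
    theta (c n) χ (Finsupp.single (rt (c n) Q Ψ) 1) = theta (c n) χ (Finsupp.single Ψ 1) + χ Q := by
  have h := theta_mapDomain_rt (c n) hadd hst Q (Finsupp.single Ψ (1 : ZMod 2))
  rwa [Finsupp.mapDomain_single, mass_single, mul_one] at h

/-- **The character of a biarc face**: `θ_χ (fplus k 0) = θ_χ[barc k 0] + θ_χ[barc (k+2) 0]` (the middle corners cancel). [folklore] -/
theorem theta_fplus (k : ZMod (2 * n)) :
    theta (c n) χ (red (c n) (fplus k 0)) = theta (c n) χ (Finsupp.single (barc k 0) 1) + theta (c n) χ (Finsupp.single (barc (k + 2) 0) 1) := by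
  rw [fplus_eq]
  simp only [map_sub, map_add, red_single, Int.cast_one]
  rw [(fplus_corners_rt k).1, (fplus_corners_rt k).2, theta_single_rt hadd hst, theta_single_rt hadd hst]
  generalize theta (c n) χ (Finsupp.single (barc k 0) 1) = x
  generalize theta (c n) χ (Finsupp.single (barc (k + 2) 0) 1) = y
  generalize theta (c n) χ (Finsupp.single (barc (k + 1) 0) 1) = z
  generalize χ (a 1) = w
  revert x y z w; decide

/-- **The character of a biarc parity cycle**: for `r ∈ ℕ`, `Σ_{t<N} θ_χ (fplus (2t + r) 0) = θ_χ[barc r 0] + θ_χ[barc (2N + r) 0]`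
(telescoping in `𝔽₂`). [folklore] -/
theorem theta_cycle_sum (r N : ℕ) :
    ∑ t ∈ range N, theta (c n) χ (red (c n) (fplus (((2 * t + r : ℕ) : ℕ) : ZMod (2 * n)) 0)) =
      theta (c n) χ (Finsupp.single (barc ((r : ℕ) : ZMod (2 * n)) 0) 1) +
        theta (c n) χ (Finsupp.single (barc (((2 * N + r : ℕ) : ℕ) : ZMod (2 * n)) 0) 1) := by
  induction N with
  | zero =>
    rw [sum_range_zero, Nat.mul_zero, Nat.zero_add]
    generalize theta (c n) χ (Finsupp.single (barc ((r : ℕ) : ZMod (2 * n)) 0) 1) = x; revert x; decide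
  | succ N ih =>
    rw [sum_range_succ, ih, theta_fplus hadd hst, show (((2 * N + r : ℕ) : ℕ) : ZMod (2 * n)) + 2 = (((2 * (N + 1) + r : ℕ) : ℕ) : ZMod (2 * n)) by
      push_cast; ring]
    generalize theta (c n) χ (Finsupp.single (barc ((r : ℕ) : ZMod (2 * n)) 0) 1) = x
    generalize theta (c n) χ (Finsupp.single (barc (((2 * N + r : ℕ) : ℕ) : ZMod (2 * n)) 0) 1) = y
    generalize theta (c n) χ (Finsupp.single (barc (((2 * (N + 1) + r : ℕ) : ℕ) : ZMod (2 * n)) 0) 1) = z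
    revert x y z; decide

/-- **THE CYCLE VALUE**: for even `n`, `θ_χ (Σ_{t<n/2} fplus (2t+r) 0) = χ (xa (r − 1))` (`barc (r+n) 0 = barc r 0 · (xa (r−1))⁻¹`). [folklore] -/
theorem theta_cycle (heven : Even n) (r : ℕ) :
    theta (c n) χ (red (c n) (∑ t ∈ range (n / 2), fplus (((2 * t + r : ℕ) : ℕ) : ZMod (2 * n)) 0)) = χ (xa (((r : ℕ) : ZMod (2 * n)) - 1)) := by
  rw [map_sum, map_sum, theta_cycle_sum hadd hst, show 2 * (n / 2) + r = r + n by obtain ⟨m, hm⟩ := heven; omega, Nat.cast_add,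
    show barc (((r : ℕ) : ZMod (2 * n)) + (n : ZMod (2 * n))) 0 = rt (c n) (xa (((r : ℕ) : ZMod (2 * n)) - 1)) (barc (r : ℕ) 0) by
      rw [barc_add_n_left_eq_rt, add_zero],
    theta_single_rt hadd hst]
  generalize theta (c n) χ (Finsupp.single (barc ((r : ℕ) : ZMod (2 * n)) 0) 1) = x
  generalize χ (xa (((r : ℕ) : ZMod (2 * n)) - 1)) = w
  revert x w; decide

end Theta

/-- **The block parity of a biarc parity cycle vanishes** (even `n`): `par (Σ_{t<n/2} fplus (2t+r) 0) = 0`. [folklore] -/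
theorem par_cycle (heven : Even n) (r : ℕ) : par (c n) (∑ t ∈ range (n / 2), fplus (((2 * t + r : ℕ) : ℕ) : ZMod (2 * n)) 0) = 0 := by
  have key : ∀ N : ℕ, par (c n) (∑ t ∈ range N, fplus (((2 * t + r : ℕ) : ℕ) : ZMod (2 * n)) 0) =
      Pi.single (blk (c n) (barc ((r : ℕ) : ZMod (2 * n)) 0)) 1 + Pi.single (blk (c n) (barc (((2 * N + r : ℕ) : ℕ) : ZMod (2 * n)) 0)) 1 := by
    intro N
    induction N with
    | zero =>
      rw [sum_range_zero, map_zero, Nat.mul_zero, Nat.zero_add]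
      funext b; simp only [Pi.zero_apply, Pi.add_apply]
      generalize (Pi.single (blk (c n) (barc ((r : ℕ) : ZMod (2 * n)) 0)) (1 : ZMod 2) : Block (c n) → ZMod 2) b = x; revert x; decide
    | succ N ih =>
      rw [sum_range_succ, map_add, ih, par_fplus, show (((2 * N + r : ℕ) : ℕ) : ZMod (2 * n)) + 2 = (((2 * (N + 1) + r : ℕ) : ℕ) : ZMod (2 * n)) by
        push_cast; ring]
      funext b; simp only [Pi.add_apply]
      generalize (Pi.single (blk (c n) (barc ((r : ℕ) : ZMod (2 * n)) 0)) (1 : ZMod 2) : Block (c n) → ZMod 2) b = x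
      generalize (Pi.single (blk (c n) (barc (((2 * N + r : ℕ) : ℕ) : ZMod (2 * n)) 0)) (1 : ZMod 2) : Block (c n) → ZMod 2) b = y
      generalize (Pi.single (blk (c n) (barc (((2 * (N + 1) + r : ℕ) : ℕ) : ZMod (2 * n)) 0)) (1 : ZMod 2) : Block (c n) → ZMod 2) b = z
      revert x y z; decide
  rw [key, show 2 * (n / 2) + r = r + n by obtain ⟨m, hm⟩ := heven; omega, Nat.cast_add,
    show barc (((r : ℕ) : ZMod (2 * n)) + (n : ZMod (2 * n))) 0 = rt (c n) (xa (((r : ℕ) : ZMod (2 * n)) - 1)) (barc (r : ℕ) 0) by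
      rw [barc_add_n_left_eq_rt, add_zero], blk_rt]
  funext b; simp only [Pi.add_apply, Pi.zero_apply]
  generalize (Pi.single (blk (c n) (barc ((r : ℕ) : ZMod (2 * n)) 0)) (1 : ZMod 2) : Block (c n) → ZMod 2) b = x; revert x; decide

/-- **THE TABLE**: `(θ_{χ_a}, θ_{χ_b})` of the even cycle is `(1, 1)`, of the odd cycle `(1, 0)` (`n = 2^m ≥ 2`). [folklore] -/
theorem theta_table (m : ℕ) (hn : n = 2 ^ m) (h2 : 2 ≤ n) :
    theta (c n) chiA (red (c n) (∑ t ∈ range (n / 2), fplus (((2 * t + 0 : ℕ) : ℕ) : ZMod (2 * n)) 0)) = 1 ∧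
      theta (c n) chiB (red (c n) (∑ t ∈ range (n / 2), fplus (((2 * t + 0 : ℕ) : ℕ) : ZMod (2 * n)) 0)) = 1 ∧
        theta (c n) chiA (red (c n) (∑ t ∈ range (n / 2), fplus (((2 * t + 1 : ℕ) : ℕ) : ZMod (2 * n)) 0)) = 1 ∧
          theta (c n) chiB (red (c n) (∑ t ∈ range (n / 2), fplus (((2 * t + 1 : ℕ) : ℕ) : ZMod (2 * n)) 0)) = 0 := by
  have heven : Even n := by
    have hm : m ≠ 0 := by rintro rfl; rw [hn] at h2; norm_num at h2
    rw [hn]; exact (Nat.even_pow' hm).mpr (by norm_num)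
  refine ⟨?_, ?_, ?_, ?_⟩
  · rw [theta_cycle chiA_mul chiA_stab heven 0]; rfl
  · rw [theta_cycle (chiB_mul heven) (chiB_stab m hn) heven 0, Nat.cast_zero, zero_sub]
    show ZMod.castHom (dvd_mul_right 2 n) (ZMod 2) (-1 : ZMod (2 * n)) = 1
    rw [map_neg, map_one]; decide
  · rw [theta_cycle chiA_mul chiA_stab heven 1]; rfl
  · rw [theta_cycle (chiB_mul heven) (chiB_stab m hn) heven 1, Nat.cast_one, sub_self]
    show ZMod.castHom (dvd_mul_right 2 n) (ZMod 2) (0 : ZMod (2 * n)) = 0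
    rw [map_zero]

end

end Summit.HodgeConjecture.CorCM.Census.QuaternionColumn
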